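import Literature.RepresentationTheory.Kovacevic2021.SU21UnitarityFromProducts
import Literature.RepresentationTheory.Kovacevic2021.SU21PrincipalSeriesReducibility
import Literature.RepresentationTheory.Kovacevic2021.SU21CohomologicalClassification
import HarnessLib

/-!
# Kovačević's Theorem 4 for the principal-series data `V(c, 2t)`: unitarity iff `a(p) < 0` and `b(q) < 0`

Continuation of `Literature.RepresentationTheory.Kovacevic2021.SU21UnitarityFromProducts` (a strongly connected
datum with a vertex and square-complete `K`-type set is unitarizable iff all edge products `A D'`, `B C'` are
negative reals), applied to Kovačević's `V(c,2t)` = `principalSeries c t` of `SU21PrincipalSeriesData` (`K`-types the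
cone `V_{1+p+q,2t+3p-3q}`, vertex `V_{1,2t}`, invariant products (b75) `A D' = (p+1) a(p)/(n(n+1))`,
(b80) `B C' = (q+1) b(q)/(n(n+1))` with `a(p) = 2c-(p+1)t-p(p+2)`, `b(q) = 2c+(q+1)t-q(q+2)`) and
`SU21PrincipalSeriesReducibility` (`V(c,2t)` is irreducible iff no `a(p)`, `b(q)` vanishes).
[Kovacevic2021, §4 Thm 4]: "`V` is unitary if and only if (c30) `a_{nm} d_{n+1,m+3} < 0` and (c35)
`b_{nm} c_{n+1,m-3} < 0`".  Proved here, for IRREDUCIBLE `V(c,2t)`: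
**`principalSeries_isUnitarizable_iff`** — `V(c,2t)` is unitarizable iff `a(p)` and `b(q)` are negative real
numbers for all `p, q ≥ 0`; in particular `c` is then real with `2c < -|t|` (`two_mul_re_lt_of_isUnitarizable`).
Theorems only; no named facts.

## References

* D. Kovačević, *Unitary `(𝔤,K)` modules of `SU(2,1)`*, Acta Math. Spalatensia 1 (2021) 105–125
  (arXiv:1810.01752): §3 Thm 3 (b75), (b80); §4 Thm 4 (c30), (c35), Thm 5. [Kovacevic2021]
-/

noncomputable section

namespace Literature.RepresentationTheory.Kovacevic2021

-- Mathlib idiom (Mathlib/Algebra/Lie/OfAssociative.lean): commutator brackets on associative algebras; needed for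
-- the `𝔤𝔩(3,ℂ)`-module structure on `𝒟.V`, as in every file of this directory.
attribute [local instance 100] LieRing.ofAssociativeRing

namespace SU21Datum

open PrincipalSeries

variable (c : ℂ) (t : ℤ)

/-! ## The hypotheses of the criterion on the cone -/

/-- the cone of `V(c,2t)` is square-complete: `(n,m∓3), (n+1,m)` `K`-types ⇒ `(n-1,m)` a `K`-type
[cite: Kovacevic2021, §3 Thm 3] -/
theorem principalSeries_squareComplete (n m : ℤ) (h1 : (n, m - 3) ∈ (principalSeries c t).S)
    (h2 : (n, m + 3) ∈ (principalSeries c t).S) (h3 : (n + 1, m) ∈ (principalSeries c t).S) :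
    (n - 1, m) ∈ (principalSeries c t).S := by
  obtain ⟨p₁, q₁, hp₁, hq₁, hn₁, hm₁⟩ := (mem_principalSeries_S_iff c t _ _).1 h1
  obtain ⟨p₂, q₂, hp₂, hq₂, hn₂, hm₂⟩ := (mem_principalSeries_S_iff c t _ _).1 h2
  obtain ⟨p, q, hp, hq, hn, hm⟩ := (mem_principalSeries_S_iff c t _ _).1 h3
  exact (mem_principalSeries_S_iff c t _ _).2 ⟨p - 1, q - 1, by omega, by omega, by omega, by omega⟩

/-- no `K`-type below the vertex: `(0, 2t ∓ 3) ∉ S` [cite: Kovacevic2021, §3 Thm 3] -/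
theorem principalSeries_below_vertex (m : ℤ) : ((1 : ℤ) - 1, m) ∉ (principalSeries c t).S := fun h => by
  have := one_le_of_mem_cone (t := t) (show ((1 : ℤ) - 1, m) ∈ cone t from h)
  omega

/-- a positive real multiple does not change the sign conditions [folklore] -/
private theorem neg_real_iff_of_pos_mul {r : ℝ} (hr : 0 < r) (a z : ℂ) (hz : z = (r : ℂ) * a) :
    (z.im = 0 ∧ z.re < 0) ↔ (a.im = 0 ∧ a.re < 0) := by
  subst hz
  rw [Complex.re_ofReal_mul, Complex.im_ofReal_mul]
  constructor
  · rintro ⟨hi, hre⟩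
    exact ⟨(mul_eq_zero.1 hi).resolve_left hr.ne', by nlinarith⟩
  · rintro ⟨hi, hre⟩
    exact ⟨by rw [hi, mul_zero], mul_neg_of_pos_of_neg hr hre⟩

/-- the `A D'` products of `V(c,2t)`: at the `K`-type `(p,q)` a positive real multiple of `a(p)`
[cite: Kovacevic2021, §3 Thm 3 (b75)] -/
theorem principalSeries_AD_sign {p q : ℤ} (hp : 0 ≤ p) (hq : 0 ≤ q) :
    let z := (principalSeries c t).A (1 + p + q) (2 * t + 3 * p - 3 * q) *
      (principalSeries c t).D (1 + p + q + 1) (2 * t + 3 * p - 3 * q + 3)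
    (z.im = 0 ∧ z.re < 0) ↔ ((acoef c t p).im = 0 ∧ (acoef c t p).re < 0) := by
  refine neg_real_iff_of_pos_mul (r := ((p : ℝ) + 1) / ((1 + p + q) * (1 + p + q + 1))) ?_ _ _ ?_
  · have : (0 : ℝ) ≤ p := by exact_mod_cast hp
    have : (0 : ℝ) ≤ q := by exact_mod_cast hq
    positivity
  · rw [principalSeries_AD c t hp hq, acoef]
    push_cast
    ring

/-- the `B C'` products of `V(c,2t)`: at the `K`-type `(p,q)` a positive real multiple of `b(q)`
[cite: Kovacevic2021, §3 Thm 3 (b80)] -/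
theorem principalSeries_BC_sign {p q : ℤ} (hp : 0 ≤ p) (hq : 0 ≤ q) :
    let z := (principalSeries c t).B (1 + p + q) (2 * t + 3 * p - 3 * q) *
      (principalSeries c t).C (1 + p + q + 1) (2 * t + 3 * p - 3 * q - 3)
    (z.im = 0 ∧ z.re < 0) ↔ ((bcoef c t q).im = 0 ∧ (bcoef c t q).re < 0) := by
  refine neg_real_iff_of_pos_mul (r := ((q : ℝ) + 1) / ((1 + p + q) * (1 + p + q + 1))) ?_ _ _ ?_
  · have : (0 : ℝ) ≤ p := by exact_mod_cast hp
    have : (0 : ℝ) ≤ q := by exact_mod_cast hq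
    positivity
  · rw [principalSeries_BC c t hp hq, bcoef]
    push_cast
    ring

/-! ## Kovačević's Theorem 4 for `V(c,2t)` -/

/-- **Kovačević's Theorem 4 for the principal series.** An irreducible `V(c,2t)` (no `a(p)`, `b(q)` vanishes,
`SU21PrincipalSeriesReducibility`) is unitarizable iff `a(p) = 2c-(p+1)t-p(p+2)` and `b(q) = 2c+(q+1)t-q(q+2)` are
negative real numbers for all `p, q ≥ 0` ((c30), (c35)). [cite: Kovacevic2021, §4 Thm 4] -/
theorem principalSeries_isUnitarizable_iff (ha : ∀ p : ℤ, 0 ≤ p → acoef c t p ≠ 0)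
    (hb : ∀ q : ℤ, 0 ≤ q → bcoef c t q ≠ 0) :
    IsUnitarizable (principalSeries c t) ↔
      (∀ p : ℤ, 0 ≤ p → (acoef c t p).im = 0 ∧ (acoef c t p).re < 0) ∧
      (∀ q : ℤ, 0 ≤ q → (bcoef c t q).im = 0 ∧ (bcoef c t q).re < 0) := by
  haveI : LieModule.IsIrreducible ℂ (Matrix (Fin 3) (Fin 3) ℂ) (principalSeries c t).V :=
    (principalSeries_isIrreducible_iff c t).2 ⟨ha, hb⟩
  have hconn : ∀ x ∈ (principalSeries c t).S, ∀ y ∈ (principalSeries c t).S, (principalSeries c t).Reach x y :=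
    forall_reach_of_isIrreducible
  rw [isUnitarizable_iff_products_neg (x₀ := ((1 : ℤ), 2 * t)) hconn (vertex_mem c t)
    (principalSeries_below_vertex c t _) (principalSeries_below_vertex c t _) (principalSeries_squareComplete c t)]
  constructor
  · rintro ⟨hA, hB⟩
    refine ⟨fun p hp => ?_, fun q hq => ?_⟩
    · have h := hA (1 + p + 0) (2 * t + 3 * p - 3 * 0) (mem_cone hp le_rfl rfl rfl)
        (mem_cone (p := p + 1) (q := 0) (by omega) le_rfl (by ring) (by ring))
      exact (principalSeries_AD_sign c t hp le_rfl).1 h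
    · have h := hB (1 + 0 + q) (2 * t + 3 * 0 - 3 * q) (mem_cone le_rfl hq rfl rfl)
        (mem_cone (p := 0) (q := q + 1) le_rfl (by omega) (by ring) (by ring))
      exact (principalSeries_BC_sign c t le_rfl hq).1 h
  · rintro ⟨hA, hB⟩
    refine ⟨fun n m hS hS' => ?_, fun n m hS hS' => ?_⟩
    · obtain ⟨p, q, hp, hq, rfl, rfl⟩ := (mem_principalSeries_S_iff c t n m).1 hS
      exact (principalSeries_AD_sign c t hp hq).2 (hA p hp)
    · obtain ⟨p, q, hp, hq, rfl, rfl⟩ := (mem_principalSeries_S_iff c t n m).1 hS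
      exact (principalSeries_BC_sign c t hp hq).2 (hB q hq)

/-- **Consequence**: if an irreducible `V(c,2t)` is unitarizable then `c` is real and `2c < -|t|`
(the conditions at `p = q = 0`: `2c - t < 0`, `2c + t < 0`). [cite: Kovacevic2021, §4 Thm 4, Thm 5] -/
theorem two_mul_re_lt_of_isUnitarizable (ha : ∀ p : ℤ, 0 ≤ p → acoef c t p ≠ 0)
    (hb : ∀ q : ℤ, 0 ≤ q → bcoef c t q ≠ 0) (hU : IsUnitarizable (principalSeries c t)) :
    c.im = 0 ∧ 2 * c.re < -|(t : ℝ)| := by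
  obtain ⟨hA, hB⟩ := (principalSeries_isUnitarizable_iff c t ha hb).1 hU
  obtain ⟨h0i, h0r⟩ := hA 0 le_rfl
  obtain ⟨h1i, h1r⟩ := hB 0 le_rfl
  simp only [acoef, bcoef, Int.cast_zero, zero_add, one_mul, zero_mul, sub_zero, Complex.sub_im, Complex.add_im,
    Complex.sub_re, Complex.add_re, Complex.mul_re, Complex.mul_im, Complex.re_ofNat, Complex.im_ofNat,
    Complex.intCast_re, Complex.intCast_im, add_zero] at h0i h0r h1i h1r
  have habs : |(t : ℝ)| < -(2 * c.re) := abs_lt.2 ⟨by linarith, by linarith⟩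
  exact ⟨by linarith, by linarith⟩

end SU21Datum

end Literature.RepresentationTheory.Kovacevic2021
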